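import Literature.Geometry.Lorentzian.SurfaceTransgression
import Literature.Geometry.Lorentzian.GreenIdentity
import HarnessLib

/-!
# The flux formula for the total curvature of a piece of a closed Riemannian surface

Let `(N, h)` be a compact Riemannian surface without boundary (modelled on `ℝ²`), `f : N → ℝ`
smooth, `u = |∇f|²`, `L = Δf`, and `ψ : N → ℝ` smooth with `df ≠ 0` on `tsupport ψ`. Then

  `∫_N ψ S dμ = −∫_N (⟨du, dψ⟩ − 2 L ⟨df, dψ⟩) / u dμ`                 (`S = 2K`)

(`integral_mul_scalarCurvature_eq_neg_integral_flux`), where `⟨·,·⟩ = h⁻¹` on differentials.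
This is the integrated form of the exactness of the curvature form away from the critical points
of `f` (`K dA = dω₁₂` for the frame `e₁ = ∇f/|∇f|`, Chern 1944, §1–§2): the right-hand side is
`−∫ dψ(W) dμ` for the vector field `W = ∇_{e₁}e₁ − (div e₁)e₁ = (½∇u − L∇f)/u`, so it only
depends on the data where `dψ ≠ 0` — the device by which the Gauss–Bonnet integral is computed
from neighbourhoods of the critical points of a Morse function (Chern 1944, §2; the classical
proof of the Poincaré–Hopf/Gauss–Bonnet theorem for surfaces).

Proof: the pointwise identity `½ S u² = ½uΔu − ½⟨du,du⟩ − u⟨dL,df⟩ + L⟨du,df⟩ − L²u`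
(`half_scalarCurvature_mul_gradSq_sq`, `SurfaceTransgression.lean`) tested against `ψ/u²`, and
Green's first identity on the closed manifold (`integral_mul_dalembertian_eq_neg_integral_innerDual`,
`GreenIdentity.lean`) applied to the pairs `(ψ/u, u)` and `(ψL/u, f)`. Everything is proved; no
definitions, no named facts.

## References

* S.-S. Chern, *A simple intrinsic proof of the Gauss–Bonnet formula for closed Riemannian
  manifolds*, Ann. of Math. 45 (1944) 747–752, §1–§2. [Chern1944]
* J. M. Lee, *Introduction to Riemannian Manifolds*, 2nd ed. (2018), Problem 2-23 (Green's
  identities), Thm. 9.3/9.7 (Gauss–Bonnet). [Lee2018]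
-/

noncomputable section

open Bundle Set Function Filter Module TopologicalSpace MeasureTheory
open scoped Manifold ContDiff Topology

namespace Literature.Geometry.Lorentzian

open Literature.Geometry.Riemannian PseudoRiemannianMetric

/-! ### Functions localised on the support of a test function -/

section Localized

variable {X : Type*} [TopologicalSpace X]

/-- A quotient `n / v` is continuous when `n` is continuous and vanishes off a closed set `K` on
which the continuous `v` does not vanish. [folklore] -/
theorem continuous_div_of_eq_zero_compl {n v : X → ℝ} {K : Set X} (hK : IsClosed K)
    (hn : Continuous n) (hv : Continuous v) (hnK : ∀ x ∉ K, n x = 0) (hvK : ∀ x ∈ K, v x ≠ 0) :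
    Continuous fun x ↦ n x / v x := by
  rw [continuous_iff_continuousAt]
  intro x
  by_cases hx : x ∈ K
  · exact (hn.continuousAt).div (hv.continuousAt) (hvK x hx)
  · have hev : (fun y ↦ n y / v y) =ᶠ[𝓝 x] fun _ ↦ 0 := by
      filter_upwards [hK.isOpen_compl.mem_nhds hx] with y hy
      rw [hnK y hy, zero_div]
    exact (continuousAt_const.congr_of_eventuallyEq hev :)

end Localized

section Manifold

variable {E : Type*} [NormedAddCommGroup E] [NormedSpace ℝ E] {H : Type*} [TopologicalSpace H]
  {I : ModelWithCorners ℝ E H} {M : Type*} [TopologicalSpace M] [ChartedSpace H M]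

/-- A quotient `a / b` of `C^n` functions is `C^n` when `b ≠ 0` on `tsupport a` (off
`tsupport a` it vanishes near every point). [folklore] -/
theorem contMDiff_div_of_tsupport {n : ℕ∞ω} {a b : M → ℝ} (ha : ContMDiff I 𝓘(ℝ, ℝ) n a)
    (hb : ContMDiff I 𝓘(ℝ, ℝ) n b) (h0 : ∀ x ∈ tsupport a, b x ≠ 0) :
    ContMDiff I 𝓘(ℝ, ℝ) n fun x ↦ a x / b x := by
  intro x
  by_cases hx : x ∈ tsupport a
  · exact (ha x).div₀ (hb x) (h0 x hx)
  · have hev : (fun y ↦ a y / b y) =ᶠ[𝓝 x] fun _ ↦ 0 := by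
      filter_upwards [(isClosed_tsupport a).isOpen_compl.mem_nhds hx] with y hy
      rw [image_eq_zero_of_notMem_tsupport hy, zero_div]
    exact contMDiffAt_const.congr_of_eventuallyEq hev

/-- The topological support of `a / b` is contained in that of `a`. [folklore] -/
theorem tsupport_div_subset (a b : M → ℝ) : tsupport (fun x ↦ a x / b x) ⊆ tsupport a :=
  closure_mono fun x hx h0 ↦ hx (by simp [h0])

end Manifold

/-! ### The flux formula -/

section Core

variable {H : Type*} [TopologicalSpace H]
  {I : ModelWithCorners ℝ (EuclideanSpace ℝ (Fin 2)) H} [I.Boundaryless]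
  {N : Type*} [TopologicalSpace N] [ChartedSpace H N] [IsManifold I ∞ N] [CompactSpace N]
  [T2Space N] [MeasurableSpace N] [BorelSpace N]
  (h : ContMDiffRiemannianMetric I ∞ (EuclideanSpace ℝ (Fin 2)) (TangentSpace I : N → Type _))
  [(ofRiemannian h).HasLeviCivita]

omit [CompactSpace N] [T2Space N] [MeasurableSpace N] [BorelSpace N] [(ofRiemannian h).HasLeviCivita] in
/-- The pairing of differentials is continuous for `C¹` functions. [folklore] -/
theorem continuous_innerDual_pair {φ χ : N → ℝ} (hφ : CMDiff 1 φ) (hχ : CMDiff 1 χ) :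
    Continuous (fun x ↦ (ofRiemannian h).innerDual x (mvfderiv I φ x : TangentSpace I x →ₗ[ℝ] ℝ)
      (mvfderiv I χ x : TangentSpace I x →ₗ[ℝ] ℝ)) :=
  continuous_innerDual_mvfderiv _ hφ hχ

/-- **The flux formula for the curvature of a closed Riemannian surface against a test
function.** For `f ∈ C^∞(N)` with `u = |∇f|²_h`, `L = Δ_h f`, and `ψ ∈ C^∞(N)` with `df ≠ 0` on
`tsupport ψ`:

  `∫_N ψ S_h dμ_h = −∫_N (h⁻¹(du, dψ) − 2 L h⁻¹(df, dψ)) / u dμ_h`,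

`S_h = 2K` the scalar curvature. The right-hand side is `−2∫ dψ(W) dμ`,
`W = ∇_{e₁}e₁ − (div e₁)e₁`, `e₁ = ∇f/|∇f|`: the integrated exactness `K dA = dω₁₂` of the
curvature form off the critical points of `f` (Chern 1944, §1–§2), obtained from the pointwise
identity `half_scalarCurvature_mul_gradSq_sq` and Green's first identity (Lee 2018,
Problem 2-23) for the pairs `(ψ/u, u)` and `(ψL/u, f)`. [cite: Chern1944, §1–§2]
[cite: Lee2018, Problem 2-23 (a)] -/
theorem integral_mul_scalarCurvature_eq_neg_integral_flux {f ψ : N → ℝ} (hf : CMDiff ∞ f)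
    (hψ : CMDiff ∞ ψ) (hsupp : ∀ x ∈ tsupport ψ, (ofRiemannian h).gradSq f x ≠ 0) :
    ∫ x, ψ x * (ofRiemannian h).scalarCurvature x ∂riemannianMeasure h =
      -∫ x, ((ofRiemannian h).innerDual x
                (mvfderiv I ((ofRiemannian h).gradSq f) x : TangentSpace I x →ₗ[ℝ] ℝ)
                (mvfderiv I ψ x : TangentSpace I x →ₗ[ℝ] ℝ)
              - 2 * (ofRiemannian h).dalembertian f x *
                (ofRiemannian h).innerDual x (mvfderiv I f x : TangentSpace I x →ₗ[ℝ] ℝ)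
                  (mvfderiv I ψ x : TangentSpace I x →ₗ[ℝ] ℝ)) /
            (ofRiemannian h).gradSq f x ∂riemannianMeasure h := by
  have hg : (ofRiemannian h).IsRiemannian := fun p v hv ↦ isRiemannian_ofRiemannian h p v hv
  have h2 : finrank ℝ (EuclideanSpace ℝ (Fin 2)) = 2 := finrank_euclideanSpace_fin
  have h2le : (2 : ℕ∞ω) ≤ ∞ := WithTop.coe_le_coe.mpr le_top
  have h1le : (1 : ℕ∞ω) ≤ ∞ := WithTop.coe_le_coe.mpr le_top
  -- the functions `u = |∇f|²`, `L = Δf` and the pairings, as atoms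
  set u : N → ℝ := (ofRiemannian h).gradSq f with hu_def
  set L : N → ℝ := (ofRiemannian h).dalembertian f with hL_def
  set S : N → ℝ := (ofRiemannian h).scalarCurvature with hS_def
  have hu_s : CMDiff ∞ u := contMDiff_gradSq _ hf
  have hL_s : CMDiff ∞ L := contMDiff_dalembertian _ hf
  have hS_s : CMDiff ∞ S := contMDiff_scalarCurvature _
  -- the test functions `φ₁ = ψ/u`, `φ₂ = ψL/u`
  set φ₁ : N → ℝ := fun x ↦ ψ x / u x with hφ₁
  set φ₂ : N → ℝ := fun x ↦ ψ x * L x / u x with hφ₂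
  have hψL : CMDiff ∞ fun x ↦ ψ x * L x := hψ.mul hL_s
  have hsuppL : ∀ x ∈ tsupport (fun x ↦ ψ x * L x), u x ≠ 0 := fun x hx ↦
    hsupp x (tsupport_mul_subset_left hx)
  have hφ₁s : CMDiff ∞ φ₁ := contMDiff_div_of_tsupport hψ hu_s hsupp
  have hφ₂s : CMDiff ∞ φ₂ := contMDiff_div_of_tsupport hψL hu_s hsuppL
  set Puu : N → ℝ := fun x ↦ (ofRiemannian h).innerDual x
    (mvfderiv I u x : TangentSpace I x →ₗ[ℝ] ℝ) (mvfderiv I u x : TangentSpace I x →ₗ[ℝ] ℝ) with hPuu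
  set PLf : N → ℝ := fun x ↦ (ofRiemannian h).innerDual x
    (mvfderiv I L x : TangentSpace I x →ₗ[ℝ] ℝ) (mvfderiv I f x : TangentSpace I x →ₗ[ℝ] ℝ) with hPLf
  set Puf : N → ℝ := fun x ↦ (ofRiemannian h).innerDual x
    (mvfderiv I u x : TangentSpace I x →ₗ[ℝ] ℝ) (mvfderiv I f x : TangentSpace I x →ₗ[ℝ] ℝ) with hPuf
  set Pψu : N → ℝ := fun x ↦ (ofRiemannian h).innerDual x
    (mvfderiv I ψ x : TangentSpace I x →ₗ[ℝ] ℝ) (mvfderiv I u x : TangentSpace I x →ₗ[ℝ] ℝ) with hPψu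
  set Pψf : N → ℝ := fun x ↦ (ofRiemannian h).innerDual x
    (mvfderiv I ψ x : TangentSpace I x →ₗ[ℝ] ℝ) (mvfderiv I f x : TangentSpace I x →ₗ[ℝ] ℝ) with hPψf
  set P1 : N → ℝ := fun x ↦ (ofRiemannian h).innerDual x
    (mvfderiv I φ₁ x : TangentSpace I x →ₗ[ℝ] ℝ) (mvfderiv I u x : TangentSpace I x →ₗ[ℝ] ℝ) with hP1
  set P2 : N → ℝ := fun x ↦ (ofRiemannian h).innerDual x
    (mvfderiv I φ₂ x : TangentSpace I x →ₗ[ℝ] ℝ) (mvfderiv I f x : TangentSpace I x →ₗ[ℝ] ℝ) with hP2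
  -- Green's identities
  have hG1 : ∫ x, φ₁ x * (ofRiemannian h).dalembertian u x ∂riemannianMeasure h =
      -∫ x, P1 x ∂riemannianMeasure h :=
    integral_mul_dalembertian_eq_neg_integral_innerDual h (hφ₁s.of_le h1le) (hu_s.of_le h2le)
  have hG2 : ∫ x, φ₂ x * L x ∂riemannianMeasure h = -∫ x, P2 x ∂riemannianMeasure h :=
    integral_mul_dalembertian_eq_neg_integral_innerDual h (hφ₂s.of_le h1le) (hf.of_le h2le)
  -- differentials off the support vanish
  have hzero : ∀ {w : N → ℝ} {x : N}, x ∉ tsupport w → mvfderiv I w x = 0 := fun hx ↦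
    mvfderiv_eq_zero_of_notMem_tsupport hx
  have hψ0 : ∀ {x : N}, x ∉ tsupport ψ → ψ x = 0 := fun hx ↦ image_eq_zero_of_notMem_tsupport hx
  -- the differential of `u⁻¹` where `u ≠ 0`
  have hdinv : ∀ {x : N}, u x ≠ 0 →
      mvfderiv I (fun y ↦ (u y)⁻¹) x = (-(u x ^ 2)⁻¹) • mvfderiv I u x := by
    intro x hux
    ext v
    have hum : MDifferentiableAt I 𝓘(ℝ, ℝ) u x := (hu_s x).mdifferentiableAt (by simp)
    have hc := mvfderiv_real_comp (I := I) (u := u) (ζ := Inv.inv) (x := x)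
      (differentiableAt_inv hux) hum v
    change mvfderiv I (Inv.inv ∘ u) x v = _
    rw [hc, deriv_inv, _root_.smul_apply, smul_eq_mul]
  -- pointwise: the differentials of the test functions
  have hdφ₁ : ∀ x, P1 x = Pψu x / u x - ψ x * Puu x / u x ^ 2 := by
    intro x
    by_cases hx : x ∈ tsupport ψ
    · have hux : u x ≠ 0 := hsupp x hx
      have hψm : MDifferentiableAt I 𝓘(ℝ, ℝ) ψ x := (hψ x).mdifferentiableAt (by simp)
      have hinv : MDifferentiableAt I 𝓘(ℝ, ℝ) (fun y ↦ (u y)⁻¹) x :=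
        ((hu_s x).inv₀ hux).mdifferentiableAt (by simp)
      have hφeq : φ₁ = fun y ↦ ψ y * (u y)⁻¹ := by funext y; simp only [hφ₁, div_eq_mul_inv]
      simp only [hP1, hPψu, hPuu, innerDual]
      rw [hφeq, mvfderiv_fun_mul hψm hinv, hdinv hux]
      simp only [ContinuousLinearMap.toLinearMap_add, ContinuousLinearMap.toLinearMap_smul,
        LinearMap.add_apply, LinearMap.smul_apply, smul_eq_mul]
      field_simp
      ring
    · have hx1 : x ∉ tsupport φ₁ := fun h' ↦ hx (tsupport_div_subset ψ u h')
      simp only [hP1, hPψu, hPuu, innerDual, hzero hx1, hzero hx, hψ0 hx,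
        ContinuousLinearMap.toLinearMap_zero, LinearMap.zero_apply, zero_div, zero_mul, sub_zero]
  have hdφ₂ : ∀ x, P2 x = L x * Pψf x / u x + ψ x * PLf x / u x - ψ x * L x * Puf x / u x ^ 2 := by
    intro x
    by_cases hx : x ∈ tsupport ψ
    · have hux : u x ≠ 0 := hsupp x hx
      have hψm : MDifferentiableAt I 𝓘(ℝ, ℝ) ψ x := (hψ x).mdifferentiableAt (by simp)
      have hLm : MDifferentiableAt I 𝓘(ℝ, ℝ) L x := (hL_s x).mdifferentiableAt (by simp)
      have hψLm : MDifferentiableAt I 𝓘(ℝ, ℝ) (fun y ↦ ψ y * L y) x := hψm.mul hLm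
      have hinv : MDifferentiableAt I 𝓘(ℝ, ℝ) (fun y ↦ (u y)⁻¹) x :=
        ((hu_s x).inv₀ hux).mdifferentiableAt (by simp)
      have hφeq : φ₂ = fun y ↦ (ψ y * L y) * (u y)⁻¹ := by
        funext y; simp only [hφ₂, div_eq_mul_inv]
      simp only [hP2, hPψf, hPLf, hPuf, innerDual]
      rw [hφeq, mvfderiv_fun_mul hψLm hinv, mvfderiv_fun_mul hψm hLm, hdinv hux]
      simp only [ContinuousLinearMap.toLinearMap_add, ContinuousLinearMap.toLinearMap_smul,
        LinearMap.add_apply, LinearMap.smul_apply, smul_eq_mul, smul_add]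
      field_simp
      ring
    · have hx2 : x ∉ tsupport φ₂ := fun h' ↦ hx
        (tsupport_mul_subset_left (tsupport_div_subset (fun y ↦ ψ y * L y) u h'))
      simp only [hP2, hPψf, hPLf, hPuf, innerDual, hzero hx2, hzero hx, hψ0 hx,
        ContinuousLinearMap.toLinearMap_zero, LinearMap.zero_apply, zero_div, zero_mul,
        mul_zero, sub_zero, add_zero]
  -- pointwise: the transgression identity tested against `ψ / u²`
  have hpt : ∀ x, ψ x * S x =
      φ₁ x * (ofRiemannian h).dalembertian u x - ψ x * Puu x / u x ^ 2
        - 2 * (ψ x * PLf x / u x) + 2 * (ψ x * L x * Puf x / u x ^ 2)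
        - 2 * (φ₂ x * L x) := by
    intro x
    by_cases hx : x ∈ tsupport ψ
    · have hux : u x ≠ 0 := hsupp x hx
      have key := half_scalarCurvature_mul_gradSq_sq (ofRiemannian h) hg h2 hf x
      have e1 : (ofRiemannian h).gradSq ((ofRiemannian h).gradSq f) x = Puu x := rfl
      have e2 : (ofRiemannian h).innerDual x
          (mvfderiv I ((ofRiemannian h).dalembertian f) x : TangentSpace I x →ₗ[ℝ] ℝ)
          (mvfderiv I f x : TangentSpace I x →ₗ[ℝ] ℝ) = PLf x := rfl
      have e3 : (ofRiemannian h).innerDual x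
          (mvfderiv I ((ofRiemannian h).gradSq f) x : TangentSpace I x →ₗ[ℝ] ℝ)
          (mvfderiv I f x : TangentSpace I x →ₗ[ℝ] ℝ) = Puf x := rfl
      rw [e1, e2, e3] at key
      change S x / 2 * u x ^ 2 = 2⁻¹ * u x * (ofRiemannian h).dalembertian u x - 2⁻¹ * Puu x
        - u x * PLf x + L x * Puf x - L x ^ 2 * u x at key
      simp only [hφ₁, hφ₂]
      field_simp
      linear_combination (2 * ψ x) * key
    · simp [hφ₁, hφ₂, hψ0 hx]
  -- the seven integrands, as atoms
  set F1 : N → ℝ := fun x ↦ φ₁ x * (ofRiemannian h).dalembertian u x with hF1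
  set F2 : N → ℝ := fun x ↦ ψ x * Puu x / u x ^ 2 with hF2
  set F3 : N → ℝ := fun x ↦ ψ x * PLf x / u x with hF3
  set F4 : N → ℝ := fun x ↦ ψ x * L x * Puf x / u x ^ 2 with hF4
  set F5 : N → ℝ := fun x ↦ φ₂ x * L x with hF5
  set F6 : N → ℝ := fun x ↦ Pψu x / u x with hF6
  set F7 : N → ℝ := fun x ↦ L x * Pψf x / u x with hF7
  -- continuity of all the integrands
  have hK : IsClosed (tsupport ψ) := isClosed_tsupport ψ
  have hoff : ∀ (F : N → ℝ) (x : N), x ∉ tsupport ψ → ψ x * F x = 0 := fun F x hx ↦ by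
    rw [hψ0 hx, zero_mul]
  have hcψ : Continuous ψ := hψ.continuous
  have hcu : Continuous u := hu_s.continuous
  have hcL : Continuous L := hL_s.continuous
  have hcS : Continuous S := hS_s.continuous
  have hcΔu : Continuous ((ofRiemannian h).dalembertian u) := (contMDiff_dalembertian _ hu_s).continuous
  have hc_uu : Continuous Puu := continuous_innerDual_pair h (hu_s.of_le h1le) (hu_s.of_le h1le)
  have hc_Lf : Continuous PLf := continuous_innerDual_pair h (hL_s.of_le h1le) (hf.of_le h1le)
  have hc_uf : Continuous Puf := continuous_innerDual_pair h (hu_s.of_le h1le) (hf.of_le h1le)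
  have hc_ψu : Continuous Pψu := continuous_innerDual_pair h (hψ.of_le h1le) (hu_s.of_le h1le)
  have hc_ψf : Continuous Pψf := continuous_innerDual_pair h (hψ.of_le h1le) (hf.of_le h1le)
  have hu2ne : ∀ x ∈ tsupport ψ, u x ^ 2 ≠ 0 := fun x hx ↦ pow_ne_zero 2 (hsupp x hx)
  have hcu2 : Continuous fun x ↦ u x ^ 2 := hcu.pow 2
  have c1 : Continuous F1 := by
    refine (continuous_div_of_eq_zero_compl hK (hcψ.mul hcΔu) hcu (hoff _) hsupp).congr ?_
    intro x; simp only [hF1, hφ₁, Pi.mul_apply]; ring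
  have c2 : Continuous F2 :=
    continuous_div_of_eq_zero_compl hK (hcψ.mul hc_uu) hcu2 (hoff _) hu2ne
  have c3 : Continuous F3 :=
    continuous_div_of_eq_zero_compl hK (hcψ.mul hc_Lf) hcu (hoff _) hsupp
  have c4 : Continuous F4 := by
    refine (continuous_div_of_eq_zero_compl hK (hcψ.mul (hcL.mul hc_uf)) hcu2 (hoff _) hu2ne).congr ?_
    intro x; simp only [hF4, Pi.mul_apply]; ring
  have c5 : Continuous F5 := by
    refine (continuous_div_of_eq_zero_compl hK (hcψ.mul (hcL.mul hcL)) hcu (hoff _) hsupp).congr ?_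
    intro x; simp only [hF5, hφ₂, Pi.mul_apply]; ring
  have c6 : Continuous F6 := by
    refine continuous_div_of_eq_zero_compl hK hc_ψu hcu (fun x hx ↦ ?_) hsupp
    simp only [hPψu, hzero hx, innerDual, ContinuousLinearMap.toLinearMap_zero, LinearMap.zero_apply]
  have c7 : Continuous F7 := by
    refine continuous_div_of_eq_zero_compl hK (hcL.mul hc_ψf) hcu (fun x hx ↦ ?_) hsupp
    simp only [hPψf, hzero hx, innerDual, ContinuousLinearMap.toLinearMap_zero, LinearMap.zero_apply,
      mul_zero]
  -- integrals as numbers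
  have i1 := integrable_of_continuous h c1
  have i2 := integrable_of_continuous h c2
  have i3 := integrable_of_continuous h c3
  have i4 := integrable_of_continuous h c4
  have i5 := integrable_of_continuous h c5
  have i6 := integrable_of_continuous h c6
  have i7 := integrable_of_continuous h c7
  set μ := riemannianMeasure h with hμ
  -- Green (i): `∫ F1 = −∫ F6 + ∫ F2`
  have hA : ∫ x, F1 x ∂μ = -(∫ x, F6 x ∂μ) + ∫ x, F2 x ∂μ := by
    have hP1int : ∫ x, P1 x ∂μ = (∫ x, F6 x ∂μ) - ∫ x, F2 x ∂μ := by
      calc ∫ x, P1 x ∂μ = ∫ x, (F6 x - F2 x) ∂μ :=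
            integral_congr_ae (Eventually.of_forall fun x ↦ by simp only [hF6, hF2]; exact hdφ₁ x)
        _ = (∫ x, F6 x ∂μ) - ∫ x, F2 x ∂μ := integral_sub i6 i2
    have hG1' : ∫ x, F1 x ∂μ = -∫ x, P1 x ∂μ := hG1
    rw [hG1', hP1int]
    ring
  -- Green (ii): `∫ F5 = −∫ F7 − ∫ F3 + ∫ F4`
  have hB : ∫ x, F5 x ∂μ = -(∫ x, F7 x ∂μ) - (∫ x, F3 x ∂μ) + ∫ x, F4 x ∂μ := by
    have hP2int : ∫ x, P2 x ∂μ = (∫ x, F7 x ∂μ) + (∫ x, F3 x ∂μ) - ∫ x, F4 x ∂μ := by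
      calc ∫ x, P2 x ∂μ = ∫ x, (F7 x + F3 x - F4 x) ∂μ :=
            integral_congr_ae (Eventually.of_forall fun x ↦ by simp only [hF7, hF3, hF4]; exact hdφ₂ x)
        _ = (∫ x, (F7 x + F3 x) ∂μ) - ∫ x, F4 x ∂μ := integral_sub (i7.add i3) i4
        _ = (∫ x, F7 x ∂μ) + (∫ x, F3 x ∂μ) - ∫ x, F4 x ∂μ := by rw [integral_add i7 i3]
    have hG2' : ∫ x, F5 x ∂μ = -∫ x, P2 x ∂μ := hG2
    rw [hG2', hP2int]
    ring
  -- the left-hand side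
  have hmain : ∫ x, ψ x * S x ∂μ =
      (∫ x, F1 x ∂μ) - (∫ x, F2 x ∂μ) - 2 * (∫ x, F3 x ∂μ) + 2 * (∫ x, F4 x ∂μ)
        - 2 * (∫ x, F5 x ∂μ) := by
    have i3' : Integrable (fun x ↦ 2 * F3 x) μ := i3.const_mul 2
    have i4' : Integrable (fun x ↦ 2 * F4 x) μ := i4.const_mul 2
    have i5' : Integrable (fun x ↦ 2 * F5 x) μ := i5.const_mul 2
    have j2 : Integrable (fun x ↦ F1 x - F2 x) μ := i1.sub i2
    have j3 : Integrable (fun x ↦ F1 x - F2 x - 2 * F3 x) μ := j2.sub i3'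
    have j4 : Integrable (fun x ↦ F1 x - F2 x - 2 * F3 x + 2 * F4 x) μ := j3.add i4'
    calc ∫ x, ψ x * S x ∂μ
        = ∫ x, (F1 x - F2 x - 2 * F3 x + 2 * F4 x - 2 * F5 x) ∂μ :=
          integral_congr_ae (Eventually.of_forall fun x ↦ by
            simp only [hF1, hF2, hF3, hF4, hF5]; exact hpt x)
      _ = (∫ x, (F1 x - F2 x - 2 * F3 x + 2 * F4 x) ∂μ) - ∫ x, 2 * F5 x ∂μ := integral_sub j4 i5'
      _ = (∫ x, (F1 x - F2 x - 2 * F3 x) ∂μ) + (∫ x, 2 * F4 x ∂μ) - ∫ x, 2 * F5 x ∂μ := by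
          rw [integral_add j3 i4']
      _ = (∫ x, (F1 x - F2 x) ∂μ) - (∫ x, 2 * F3 x ∂μ) + (∫ x, 2 * F4 x ∂μ) - ∫ x, 2 * F5 x ∂μ := by
          rw [integral_sub j2 i3']
      _ = (∫ x, F1 x ∂μ) - (∫ x, F2 x ∂μ) - (∫ x, 2 * F3 x ∂μ) + (∫ x, 2 * F4 x ∂μ)
            - ∫ x, 2 * F5 x ∂μ := by rw [integral_sub i1 i2]
      _ = _ := by rw [integral_const_mul, integral_const_mul, integral_const_mul]
  -- the right-hand side
  have hR : ∫ x, ((ofRiemannian h).innerDual x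
          (mvfderiv I u x : TangentSpace I x →ₗ[ℝ] ℝ) (mvfderiv I ψ x : TangentSpace I x →ₗ[ℝ] ℝ)
        - 2 * L x * (ofRiemannian h).innerDual x (mvfderiv I f x : TangentSpace I x →ₗ[ℝ] ℝ)
          (mvfderiv I ψ x : TangentSpace I x →ₗ[ℝ] ℝ)) / u x ∂μ =
      (∫ x, F6 x ∂μ) - 2 * ∫ x, F7 x ∂μ := by
    have hpt' : ∀ x, ((ofRiemannian h).innerDual x
          (mvfderiv I u x : TangentSpace I x →ₗ[ℝ] ℝ) (mvfderiv I ψ x : TangentSpace I x →ₗ[ℝ] ℝ)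
        - 2 * L x * (ofRiemannian h).innerDual x (mvfderiv I f x : TangentSpace I x →ₗ[ℝ] ℝ)
          (mvfderiv I ψ x : TangentSpace I x →ₗ[ℝ] ℝ)) / u x = F6 x - 2 * F7 x := by
      intro x
      have e1 : (ofRiemannian h).innerDual x
          (mvfderiv I u x : TangentSpace I x →ₗ[ℝ] ℝ) (mvfderiv I ψ x : TangentSpace I x →ₗ[ℝ] ℝ)
          = Pψu x := by
        simp only [hPψu]
        exact (ofRiemannian h).innerDual_comm x _ _
      have e2 : (ofRiemannian h).innerDual x
          (mvfderiv I f x : TangentSpace I x →ₗ[ℝ] ℝ) (mvfderiv I ψ x : TangentSpace I x →ₗ[ℝ] ℝ)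
          = Pψf x := by
        simp only [hPψf]
        exact (ofRiemannian h).innerDual_comm x _ _
      rw [e1, e2]
      simp only [hF6, hF7]
      ring
    calc ∫ x, ((ofRiemannian h).innerDual x
          (mvfderiv I u x : TangentSpace I x →ₗ[ℝ] ℝ) (mvfderiv I ψ x : TangentSpace I x →ₗ[ℝ] ℝ)
        - 2 * L x * (ofRiemannian h).innerDual x (mvfderiv I f x : TangentSpace I x →ₗ[ℝ] ℝ)
          (mvfderiv I ψ x : TangentSpace I x →ₗ[ℝ] ℝ)) / u x ∂μ
        = ∫ x, (F6 x - 2 * F7 x) ∂μ := integral_congr_ae (Eventually.of_forall hpt')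
      _ = (∫ x, F6 x ∂μ) - ∫ x, 2 * F7 x ∂μ := integral_sub i6 (i7.const_mul 2)
      _ = _ := by rw [integral_const_mul]
  rw [hmain, hR, hA, hB]
  ring

end Core

end Literature.Geometry.Lorentzian

end
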